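import Literature.Probability.RandomPlanarGeometry.HexSAWStripWidthTwoKernel
import Literature.Probability.RandomPlanarGeometry.HexSAWStripBridgeLengthPointwiseLaw
import HarnessLib

/-!
# The width-two strip: the hat bridge sums obey a FIRST-ORDER 4×4 matrix recursion `D̂(k+1) = G·D̂(k)` with an explicit `G`
# (module «WIDTH-TWO HAT RECURSION»)

Topic `Literature/Probability/RandomPlanarGeometry` (continues «WIDTH-TWO-KERNEL» #715 `HexSAWStripWidthTwoKernel.lean` — `W2.LMM_two_eq` (the
irreducible bridges of `S₂` have length `1` or `2`: `M(1) = lenOneTwo y`, `M(2) = lenTwoTwo`), `W2.kerTwo`, `W2.uTwo`/`W2.ellTwo`, `W2.kerTwo_fixed` — and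
«LENGTH-POINTWISE-LAW» `HexSAWStripBridgeLengthPointwiseLaw.lean` — the hat kernel pair `HV.hatM T y k`, `HV.hatD T y k` (lengths `2k + χ_a − χ_b`) and
the matrix renewal equation `HV.hat_ren : D̂(k) = M̂(k) + Σ_{i+j=k} M̂(i)·D̂(j)`).  Lane «pcv-sawmu» (CriticalPhenomena venture), a-p2 g26 — CAR V-B (part 1)
of the lineage's variance-rate design (`HOME/pub-sawmu-a-p2/g26/DESIGN-VARIANCE-RATE-T2.md` §4).  At `T = 2` the hat kernel is supported on `k ∈ {0, 1}`
and `M̂(0)² = 0`, so the renewal equation COLLAPSES to a first-order linear recursion with the explicit matrix `G = (1 + M̂(0))·M̂(1)`; every length /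
contact asymptotic of long width-two bridges is then a statement about powers of one 4×4 matrix (eigenvalues at `y₂`: `1`, `0` and a complex pair of
modulus `1/√(6+5√2) = 0.2766`; next cars).  Sources of the SETTING: H. Duminil-Copin, A. Hammond, CMP 324 (2013) §2.2 (renewal structure of bridges);
W. Feller I (1968) XIII.3 (renewal equation; periodic case); R. P. Stanley, EC1 (2012) §4.1 Thm 4.1.1 (rational generating functions ⇔ linear recurrences).
Nothing below is printed.

## What is proved (namespaces `…SAW.HV.W2`; `x = x_c`; levels `0,1` = bottom rail, `2,3` = top rail; `χ_a = a mod 2`)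

* `hatM_two_apply` (every entry of `M̂(k)` at `T = 2` is `lenOneTwo`/`lenTwoTwo`/`0` according to `2k + χ_a − χ_b ∈ {1}, {2}, else`);
  ★ `hatM_two_zero : M̂(0) = hatMZeroTwo` (entries `(1,0) = (3,2) = x`), ★ `hatM_two_one : M̂(1) = hatMOneTwo y` (entries `(0,1) = x`, `(0,2) = x²`,
  `(2,3) = x·y`, `(3,1) = x²`), ★ `hatM_two_eq_zero : M̂(k) = 0` for `k ≥ 2`; `hatMZeroTwo_mul_self : M̂(0)² = 0`.
* ★★★ **`hatD_two_succ : D̂(k+1) = gTwo y · D̂(k)`** for every `k ≥ 1` and `0 ≤ y`, with the EXPLICIT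
  `gTwo y = (0, x, x², 0 | 0, x², x³, 0 | 0, 0, 0, x·y | 0, x², 0, x²·y) = (1 + M̂(0))·M̂(1)` (`gTwo_eq`); ★★ `hatD_two_eq_pow : D̂(k) = (gTwo y)^(k−1) · D̂(1)` (`k ≥ 1`).
* ★ `gTwo_cayleyHamilton : G⁴ − x²(1+y)G³ + x⁴yG² − x⁶yG = 0` (so every entry sequence of `k ↦ D̂(k)` satisfies the order-4 recurrence with
  characteristic polynomial `λ⁴·det(1 − M(1/λ))`, `det(1 − M(t)) = 1 − x²(1+y)t² + x⁴yt⁴ − x⁶yt⁶` the kernel determinant of #715);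
  ★ `gTwo_mulVec_uTwo : gTwo y₂ ·ᵥ uTwo = uTwo` (the Perron vector of #715 is fixed by `G` at criticality).

Label: LANE THEOREM (own result of lane «pcv-sawmu», a-p2 g26, 2026-08-27; not in print).  NOT claimed: the spectral decomposition `G = P + N` at `y₂`
and the geometric convergence `D̂(k) → A` with explicit rate (CAR V-B part 2), the contact recursions (CAR V-C), any `T ≥ 3`.
-/

noncomputable section

open Finset Filter Topology Matrix Literature.Probability.LatticeModels Literature.Probability.Percolation

namespace Literature.Probability.RandomPlanarGeometry.SAW

namespace HV

namespace W2

/-- The hat kernel of `S₂` at hat index `0`: the two down-rungs inside a column pair, `(1,0)` and `(3,2)`, weight `x` (length `1 = χ_a − χ_b`).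
[cite: DuminilCopinHammond2013, §2.2; lane «pcv-sawmu» a-p2 g26] -/
def hatMZeroTwo : Matrix (Fin (2 * 2)) (Fin (2 * 2)) ℝ :=
  Matrix.of ![![0, 0, 0, 0], ![hexCriticalFugacity, 0, 0, 0], ![0, 0, 0, 0], ![0, 0, hexCriticalFugacity, 0]]

/-- The hat kernel of `S₂` at hat index `1`: `(0,1) = x`, `(0,2) = x²`, `(2,3) = x·y` (the surface contact), `(3,1) = x²` (lengths `2 + χ_a − χ_b ∈ {1, 2}`).
[cite: DuminilCopinHammond2013, §2.2; lane «pcv-sawmu» a-p2 g26] -/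
def hatMOneTwo (y : ℝ) : Matrix (Fin (2 * 2)) (Fin (2 * 2)) ℝ :=
  Matrix.of ![![0, hexCriticalFugacity, hexCriticalFugacity ^ 2, 0], ![0, 0, 0, 0], ![0, 0, 0, hexCriticalFugacity * y],
    ![0, hexCriticalFugacity ^ 2, 0, 0]]

/-- ★ **The one-step hat transfer matrix of `S₂`**: `G(y) = (1 + M̂(0))·M̂(1) = (0, x, x², 0 | 0, x², x³, 0 | 0, 0, 0, xy | 0, x², 0, x²y)`.
[cite: Feller1968, XIII.3; Stanley2012EC1, §4.1 Theorem 4.1.1; lane «pcv-sawmu» a-p2 g26 — own] -/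
def gTwo (y : ℝ) : Matrix (Fin (2 * 2)) (Fin (2 * 2)) ℝ :=
  Matrix.of ![![0, hexCriticalFugacity, hexCriticalFugacity ^ 2, 0], ![0, hexCriticalFugacity ^ 2, hexCriticalFugacity ^ 3, 0],
    ![0, 0, 0, hexCriticalFugacity * y], ![0, hexCriticalFugacity ^ 2, 0, hexCriticalFugacity ^ 2 * y]]

/-- Every entry of the width-two hat kernel: `M̂(k)_{ab} = M(1)_{ab}` if `2k + χ_a − χ_b = 1`, `= M(2)_{ab}` if `= 2`, and `0` otherwise
(truncation independence + `LMM_two_eq`). [cite: DuminilCopinHammond2013, §2.2; lane «pcv-sawmu» a-p2 g26] -/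
theorem hatM_two_apply (y : ℝ) (k : ℕ) (a b : Fin (2 * 2)) :
    hatM 2 y k a b = if hatLen k a b = 1 then lenOneTwo y a b else if hatLen k a b = 2 then lenTwoTwo a b else 0 := by
  have hχa := (lchi_facts a).1
  have hχb := (lchi_facts b).1
  have hσN : hatLen k a b ≤ ((2 * k + 1 : ℕ) : ℤ) := by unfold hatLen; push_cast; omega
  rw [hatM]
  by_cases h1 : hatLen k a b = 1
  · rw [if_pos h1, h1]
    have h := (LUM_LMM_eq_of_le (T := 2) (σ := (1 : ℤ)) (N := 2 * k + 1) (N' := 1) (by push_cast; omega) (by norm_num) y).2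
    rw [h, show ((1 : ℤ)) = ((1 : ℕ) : ℤ) by norm_num, LMM_two_eq 1 y]
    simp
  rw [if_neg h1]
  by_cases h2 : hatLen k a b = 2
  · rw [if_pos h2, h2]
    have hk : 1 ≤ k := by unfold hatLen at h2; omega
    have h := (LUM_LMM_eq_of_le (T := 2) (σ := (2 : ℤ)) (N := 2 * k + 1) (N' := 2) (by push_cast; omega) (by norm_num) y).2
    rw [h, show ((2 : ℤ)) = ((2 : ℕ) : ℤ) by norm_num, LMM_two_eq 2 y]
    simp
  rw [if_neg h2]
  by_cases h0 : hatLen k a b ≤ 0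
  · exact LMM_eq_zero_of_le h0 y a b
  · -- `hatLen ≥ 3`: move the truncation to the length itself and use the classification
    have h3 : 3 ≤ hatLen k a b := by omega
    obtain ⟨n, hn⟩ : ∃ n : ℕ, hatLen k a b = (n : ℤ) := ⟨(hatLen k a b).toNat, (Int.toNat_of_nonneg (by omega)).symm⟩
    have hn3 : 3 ≤ n := by omega
    have h := (LUM_LMM_eq_of_le (T := 2) (σ := hatLen k a b) (N := 2 * k + 1) (N' := n) hσN (by omega) y).2
    rw [h, hn, LMM_two_eq n y, if_neg (by omega), if_neg (by omega)]
    simp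

/-- ★ `M̂(0) = hatMZeroTwo` at width two. [cite: DuminilCopinHammond2013, §2.2; lane «pcv-sawmu» a-p2 g26] -/
theorem hatM_two_zero (y : ℝ) : hatM 2 y 0 = hatMZeroTwo := by
  ext a b
  rw [hatM_two_apply]
  fin_cases a <;> fin_cases b <;> simp [hatLen, lchi, hatMZeroTwo, lenOneTwo]

/-- ★ `M̂(1) = hatMOneTwo y` at width two. [cite: DuminilCopinHammond2013, §2.2; lane «pcv-sawmu» a-p2 g26] -/
theorem hatM_two_one (y : ℝ) : hatM 2 y 1 = hatMOneTwo y := by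
  ext a b
  rw [hatM_two_apply]
  fin_cases a <;> fin_cases b <;> simp [hatLen, lchi, hatMOneTwo, lenOneTwo, lenTwoTwo]

/-- ★ `M̂(k) = 0` for `k ≥ 2` at width two (no irreducible bridge of `S₂` has three or more steps). [cite: DuminilCopinHammond2013, §2.2; lane «pcv-sawmu» a-p2 g26] -/
theorem hatM_two_eq_zero (y : ℝ) {k : ℕ} (hk : 2 ≤ k) : hatM 2 y k = 0 := by
  ext a b
  have hχa := (lchi_facts a).1
  have hχb := (lchi_facts b).1
  rw [hatM_two_apply, Matrix.zero_apply, if_neg (by unfold hatLen; omega), if_neg (by unfold hatLen; omega)]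

/-- `M̂(0)² = 0` (two down-rungs never compose). [cite: DuminilCopinHammond2013, §2.2; lane plumbing] -/
theorem hatMZeroTwo_mul_self : hatMZeroTwo * hatMZeroTwo = 0 := by
  ext a b
  fin_cases a <;> fin_cases b <;> simp [hatMZeroTwo, Matrix.mul_apply, Fin.sum_univ_four]

/-- `G = (1 + M̂(0))·M̂(1)`. [cite: Feller1968, XIII.3; lane «pcv-sawmu» a-p2 g26] -/
theorem gTwo_eq (y : ℝ) : gTwo y = (1 + hatMZeroTwo) * hatMOneTwo y := by
  ext a b
  fin_cases a <;> fin_cases b <;> simp [gTwo, hatMZeroTwo, hatMOneTwo, Matrix.mul_apply, Matrix.add_apply, Fin.sum_univ_four] <;> ring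

/-- ★★★ **The hat bridge sums of the width-two strip obey a first-order recursion: `D̂(k+1) = G·D̂(k)` for `k ≥ 1`** (`0 ≤ y`).  From `hat_ren`
at `k+1`: only `M̂(0)D̂(k+1)` and `M̂(1)D̂(k)` survive, `(1 − M̂(0))D̂(k+1) = M̂(1)D̂(k)`, and `(1 − M̂(0))⁻¹ = 1 + M̂(0)` by `M̂(0)² = 0`.
[cite: Feller1968, XIII.3 (the renewal equation); DuminilCopinHammond2013, §2.2; lane «pcv-sawmu» a-p2 g26 — own result, not in print] -/
theorem hatD_two_succ {y : ℝ} (hy : 0 ≤ y) {k : ℕ} (hk : 1 ≤ k) : hatD 2 y (k + 1) = gTwo y * hatD 2 y k := by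
  have hren := hat_ren (T := 2) hy (k + 1)
  rw [Finset.Nat.sum_antidiagonal_succ] at hren
  obtain ⟨m, rfl⟩ : ∃ m, k = m + 1 := ⟨k - 1, by omega⟩
  rw [Finset.Nat.sum_antidiagonal_succ] at hren
  have hrest : ∑ p ∈ antidiagonal m, hatM 2 y (p.1 + 1 + 1) * hatD 2 y p.2 = 0 :=
    Finset.sum_eq_zero fun p _ => by rw [hatM_two_eq_zero y (by omega), Matrix.zero_mul]
  rw [hrest, add_zero, hatM_two_eq_zero y (by omega), zero_add, hatM_two_zero, hatM_two_one] at hren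
  simp only at hren
  -- hren : D̂(m+2) = M̂0 · D̂(m+2) + M̂1 · D̂(m+1); multiply by (1 + M̂0)
  have key : (1 + hatMZeroTwo) * (hatD 2 y (m + 1 + 1) - hatMZeroTwo * hatD 2 y (m + 1 + 1)) = hatD 2 y (m + 1 + 1) := by
    rw [Matrix.mul_sub, Matrix.add_mul, Matrix.one_mul, Matrix.add_mul, Matrix.one_mul, ← Matrix.mul_assoc, hatMZeroTwo_mul_self, Matrix.zero_mul]
    abel
  have hsub : hatD 2 y (m + 1 + 1) - hatMZeroTwo * hatD 2 y (m + 1 + 1) = hatMOneTwo y * hatD 2 y (m + 1) := by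
    rw [sub_eq_iff_eq_add']
    exact hren
  rw [gTwo_eq, Matrix.mul_assoc, ← hsub, key]

/-- ★★ **`D̂(k) = G^(k−1)·D̂(1)` for `k ≥ 1`**: every hat bridge sum of `S₂` is an entry of a power of the explicit matrix `G`.
[cite: Stanley2012EC1, §4.1 Theorem 4.1.1; Feller1968, XIII.3; lane «pcv-sawmu» a-p2 g26 — own result] -/
theorem hatD_two_eq_pow {y : ℝ} (hy : 0 ≤ y) {k : ℕ} (hk : 1 ≤ k) : hatD 2 y k = gTwo y ^ (k - 1) * hatD 2 y 1 := by
  obtain ⟨m, rfl⟩ : ∃ m, k = m + 1 := ⟨k - 1, by omega⟩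
  simp only [Nat.add_sub_cancel]
  induction m with
  | zero => simp
  | succ n ih => rw [hatD_two_succ hy (by omega), ih (by omega), pow_succ', Matrix.mul_assoc]

/-- ★ **Cayley–Hamilton for `G`**: `G⁴ − x²(1+y)·G³ + x⁴y·G² − x⁶y·G = 0` — the characteristic polynomial of `G` is `λ·(λ³ − x²(1+y)λ² + x⁴yλ − x⁶y)
= λ⁴·det(1 − M(1/λ))` (`det(1 − M(t)) = 1 − x²(1+y)t² + x⁴yt⁴ − x⁶yt⁶`, #715's kernel determinant in the length variable); hence every entry of
`k ↦ D̂(k)` satisfies this order-four linear recurrence. [cite: Stanley2012EC1, §4.1 Theorem 4.1.1 (iii); lane «pcv-sawmu» a-p2 g26 — own computation] -/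
theorem gTwo_cayleyHamilton (y : ℝ) :
    gTwo y ^ 4 - (hexCriticalFugacity ^ 2 * (1 + y)) • gTwo y ^ 3 + (hexCriticalFugacity ^ 4 * y) • gTwo y ^ 2
      - (hexCriticalFugacity ^ 6 * y) • gTwo y = 0 := by
  ext a b
  fin_cases a <;> fin_cases b <;>
    simp [gTwo, pow_succ, Matrix.sub_apply] <;> ring

/-- The hat recursion entrywise along a power: `D̂(k+4) = x²(1+y)D̂(k+3) − x⁴yD̂(k+2) + x⁶yD̂(k+1)` for `k ≥ 1` (Cayley–Hamilton applied to `G^(k−1)D̂(1)`).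
[cite: Stanley2012EC1, §4.1 Theorem 4.1.1 (iii); lane «pcv-sawmu» a-p2 g26 — own] -/
theorem hatD_two_rec {y : ℝ} (hy : 0 ≤ y) {k : ℕ} (hk : 1 ≤ k) :
    hatD 2 y (k + 4) = (hexCriticalFugacity ^ 2 * (1 + y)) • hatD 2 y (k + 3) - (hexCriticalFugacity ^ 4 * y) • hatD 2 y (k + 2)
      + (hexCriticalFugacity ^ 6 * y) • hatD 2 y (k + 1) := by
  have hCH := gTwo_cayleyHamilton y
  have e4 : hatD 2 y (k + 4) = gTwo y ^ 4 * hatD 2 y k := by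
    rw [hatD_two_eq_pow hy (by omega : 1 ≤ k + 4), hatD_two_eq_pow hy hk, ← Matrix.mul_assoc, ← pow_add]; congr 2; omega
  have e3 : hatD 2 y (k + 3) = gTwo y ^ 3 * hatD 2 y k := by
    rw [hatD_two_eq_pow hy (by omega : 1 ≤ k + 3), hatD_two_eq_pow hy hk, ← Matrix.mul_assoc, ← pow_add]; congr 2; omega
  have e2 : hatD 2 y (k + 2) = gTwo y ^ 2 * hatD 2 y k := by
    rw [hatD_two_eq_pow hy (by omega : 1 ≤ k + 2), hatD_two_eq_pow hy hk, ← Matrix.mul_assoc, ← pow_add]; congr 2; omega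
  have e1 : hatD 2 y (k + 1) = gTwo y * hatD 2 y k := hatD_two_succ hy hk
  have : (gTwo y ^ 4 - (hexCriticalFugacity ^ 2 * (1 + y)) • gTwo y ^ 3 + (hexCriticalFugacity ^ 4 * y) • gTwo y ^ 2
      - (hexCriticalFugacity ^ 6 * y) • gTwo y) * hatD 2 y k = 0 := by rw [hCH, Matrix.zero_mul]
  rw [Matrix.sub_mul, Matrix.add_mul, Matrix.sub_mul, Matrix.smul_mul, Matrix.smul_mul, Matrix.smul_mul, ← e4, ← e3, ← e2, ← e1] at this
  rw [← sub_eq_zero]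
  rw [← this]
  abel

/-- ★ **`G(y₂)` fixes the Perron vector of #715**: `gTwo y₂ ·ᵥ uTwo = uTwo` (from `K u = u`, `K = M̂(0) + M̂(1)`, and `M̂(0)² = 0`).
[cite: Seneta1973, §1.4; lane «pcv-sawmu» a-p2 g26 — own] -/
theorem gTwo_mulVec_uTwo : gTwo (stripYT 2) *ᵥ uTwo = uTwo := by
  have hP := xc_minpoly
  have hy := seven_mul_stripYT_two
  ext a
  fin_cases a <;> simp [gTwo, uTwo, Matrix.mulVec, dotProduct, Fin.sum_univ_four]
  · linear_combination (-8 * hexCriticalFugacity) * hP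
  · linear_combination (-2 : ℝ) * hP - 8 * hexCriticalFugacity ^ 2 * hP
  · linear_combination hexCriticalFugacity * hy
  · linear_combination (-7 : ℝ) * hP + hexCriticalFugacity ^ 2 * hy

end W2

end HV

end Literature.Probability.RandomPlanarGeometry.SAW
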